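import Literature.NumberTheory.LFunctions.Zhang2022.RepairGapPartIIIDoors
import Literature.NumberTheory.LFunctions.Zhang2022.Section16RhoStar
import HarnessLib

/-!
# Zhang (2022), rescue GAP/BED (D-0124 (3)(4)): §16 p. 95 «`𝓡₂* = β₁ + O(𝓛⁻¹⁰)`, `𝓡₂ⱼ = −1/(β₁L′(1,χ)) + O(𝓛⁶)`»
# under the minimum premise `‖L(1,χ)‖ ≤ 𝓛⁻¹⁵` (GAP G-31 «(A)-exponent E: main terms only E ≥ 15»; node (18.1) inputs)

Topic `Literature/NumberTheory/LFunctions/Zhang2022` (Landau–Siegel audit tree; verdict-neutral).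
Y. Zhang, *Discrete mean estimates and the Landau–Siegel zero*, arXiv:2211.02515v1 (2022)
[Zhang2022LandauSiegel] — **an unrefereed manuscript under adjudication; nothing in this file asserts or
denies its Theorems 1–2, and nothing here is a claim about Landau–Siegel zeros. The programme SEARCHES and
TYPES; no claim about Landau–Siegel zeros, Theorems 1–2 of arXiv:2211.02515 or a repaired Margin232 until a
kernel theorem says so.**

The two §16 residue evaluations of DAG node `Z22:§16.u043` («by Lemma 5.8 and direct calculation,
`𝓡₂* = β₁ + O(1/𝓛¹⁰)` and `𝓡₂ⱼ = −1/(β₁L′(1,χ)) + O(𝓛⁶)`», §16 p. 95, tex L4674–L4677) are tree theorems under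
the printed Assumption (A) (`Skeleton.rhoStar_estimate`, from the CLAIM node `Skeleton.Lemma54`; `Skeleton.rho2_estimate`),
assembled from pointwise cores with every input explicit (`Skeleton.rhoStar_core`, `Skeleton.residue_one_final`,
`Skeleton.residue_two_final`) and the two (A)-doors Lemma 5.7 (`D/φ(D) ≤ 4e‖L′(1,χ)‖`) and Lemma 5.8 at a shift.
Here the SAME cores are fed through the doors' minimum-premise twins (`Repair.Gap.self_div_totient_le_norm_deriv_L_one_pow15`,
`Repair.Gap.lemma58_at_shift_pow15`, file `RepairGapPartIIIDoors`): the two evaluations hold, SAME CONSTANTS, for all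
large `D` and every real primitive `χ (mod D)` with `‖L(1,χ)‖ ≤ 𝓛⁻¹⁵` — hence under `Repair.Bed.AssumptionAWith E`
for every real `E ≥ 15` (`…_of_assumptionAWith`), the printed (A) being `E = 2022`. The wrappers are the tree's,
verbatim, with `hA ↦ h15`. Theorems only; no definition, no named fact; nothing about (A) itself.

## References

* Y. Zhang, arXiv:2211.02515v1 (2022), §16 p. 90 (`𝓡₂*`, `𝓡₂ⱼ`), p. 95; §5 Lemmas 5.4, 5.7, 5.8.
  [cite: Zhang2022LandauSiegel, §16 p. 95]
-/

noncomputable section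

open Complex Real Filter Topology

namespace Literature.NumberTheory.LFunctions.Zhang2022.Repair.Gap

open Literature.NumberTheory.LFunctions.Zhang2022.Skeleton
open Literature.NumberTheory.LFunctions.Zhang2022.Repair.Bed (AssumptionAWith)

/-- **`ζ(1+z) = 1/z + O(1)` near `z = 0`** (Mathlib's `ζ(s) − 1/(s−1) → γ`): there are `r > 0` and `M ≥ 0`
with `‖ζ(1+z) − z⁻¹‖ ≤ M` for `0 < ‖z‖ < r` (the tree's private `Skeleton.zeta_near_one'`, restated privately).
[cite: Zhang2022LandauSiegel, §16 p. 95] -/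
private theorem zeta_near_one_shift : ∃ r : ℝ, 0 < r ∧ ∃ M : ℝ, 0 ≤ M ∧ ∀ z : ℂ, z ≠ 0 → ‖z‖ < r →
    ‖riemannZeta (1 + z) - z⁻¹‖ ≤ M := by
  have h := tendsto_riemannZeta_sub_one_div
  have h2 := Metric.tendsto_nhds.mp h 1 one_pos
  rw [eventually_nhdsWithin_iff, Metric.eventually_nhds_iff] at h2
  obtain ⟨r, hr, hball⟩ := h2
  refine ⟨r, hr, ‖(Real.eulerMascheroniConstant : ℂ)‖ + 1, by positivity, fun z hz hzr => ?_⟩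
  have hmem : dist (1 + z) (1 : ℂ) < r := by simpa [dist_eq_norm] using hzr
  have hne : (1 + z : ℂ) ∈ ({1}ᶜ : Set ℂ) := by simpa using hz
  have h3 := hball hmem hne
  rw [dist_eq_norm, add_sub_cancel_left, one_div] at h3
  calc ‖riemannZeta (1 + z) - z⁻¹‖
      = ‖(riemannZeta (1 + z) - z⁻¹ - Real.eulerMascheroniConstant) +
          (Real.eulerMascheroniConstant : ℂ)‖ := by ring_nf
    _ ≤ ‖riemannZeta (1 + z) - z⁻¹ - Real.eulerMascheroniConstant‖ +
          ‖(Real.eulerMascheroniConstant : ℂ)‖ := norm_add_le _ _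
    _ ≤ 1 + ‖(Real.eulerMascheroniConstant : ℂ)‖ := by gcongr
    _ = _ := by ring

/-! ## `𝓡₂* = β₁ + O(𝓛⁻¹⁰)` under `‖L(1,χ)‖ ≤ 𝓛⁻¹⁵` -/

/-- **§16 p. 95 «`𝓡₂* = β₁ + O(1/𝓛¹⁰)`» under the minimum premise** (twin of `Skeleton.rhoStar_estimate`, same
`O`-constant `2π²C + 4eC₅₈(1 + πC)`): from the CLAIM node `Skeleton.Lemma54` (Lemma 5.4 (ii) at `s = 1`), for all large
`D` and every real primitive `χ (mod D)` with `‖L(1,χ)‖ ≤ 𝓛⁻¹⁵`, `‖L(1+β₁,χ)δ(1)/L′(1,χ) − β₁‖ ≤ C𝓛⁻¹⁰` — the tree's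
wrapper verbatim over `Skeleton.rhoStar_core`, with the (A)-guarded Lemma 5.7 / 5.8 replaced by their `𝓛⁻¹⁵` doors.
[cite: Zhang2022LandauSiegel, §16 p. 95] -/
theorem rhoStar_estimate_pow15 (c' : ℝ) (h54 : Lemma54) : ∃ C : ℝ, ForAllLarge fun D _ χ =>
    ‖χ.LFunction 1‖ ≤ 1 / Real.log D ^ 15 →
    ‖χ.LFunction (1 + beta1 c' D) / deriv χ.LFunction 1 * deltaW D 1 - beta1 c' D‖ ≤
      C * (ell D ^ 10)⁻¹ := by
  obtain ⟨k, C54, D54, h54'⟩ := h54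
  set C' : ℝ := max C54 0 with hC'
  have hC'0 : 0 ≤ C' := le_max_right _ _
  set C58 : ℝ := 1 + 16 * Real.exp (9 / 2) * π ^ 2 * 10 ^ 2 with hC58
  have hC58pos : 0 ≤ C58 := by positivity
  obtain ⟨Dl, hDl⟩ := self_div_totient_le_norm_deriv_L_one_pow15
  obtain ⟨D₂, h₂⟩ := exists_forall_le_ell (max 3 (14 * π * |c'| + 1))
  refine ⟨2 * π ^ 2 * C' + 4 * Real.exp 1 * C58 * (1 + π * C'), max (max D₂ Dl) D54,
    fun D _ χ hD hq hp h15 => ?_⟩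
  have hT := h₂ D (le_trans (le_trans (le_max_left _ _) (le_max_left _ _)) hD)
  have hℓ3 : 3 ≤ ell D := le_trans (le_max_left _ _) hT
  have hℓc : 14 * π * |c'| + 1 ≤ ell D := le_trans (le_max_right _ _) hT
  have hℓ1 : 1 ≤ ell D := by linarith
  have hℓ0 : 0 < ell D := by linarith
  have hα9 : alpha D * ell D ^ 9 = π := alpha_mul_ell_pow_nine hℓ0
  have hα : 0 < alpha D := alpha_pos_of_ell_pos hℓ0
  obtain ⟨-, h5⟩ := c_alpha_ell_small c' hℓ1 hℓc
  obtain ⟨-, hβ1u⟩ := norm_beta1_bounds c' hα.le (by positivity) h5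
  -- Lemma 5.4 (ii) at `s = 1`
  obtain ⟨-, hδ⟩ := h54' D χ (le_trans (le_max_right _ _) hD) hq hp 1
  have hδ1 : ‖deltaW D 1 - 1‖ ≤ C' * alpha D * Real.log (ell D) := by
    have h := hδ (by rw [sub_self, norm_zero]; positivity)
    refine h.trans ?_
    have : 0 ≤ alpha D * Real.log (ell D) := mul_nonneg hα.le (Real.log_nonneg hℓ1)
    calc C54 * alpha D * Real.log (ell D) = C54 * (alpha D * Real.log (ell D)) := by ring
      _ ≤ C' * (alpha D * Real.log (ell D)) := mul_le_mul_of_nonneg_right (le_max_left _ _) this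
      _ = C' * alpha D * Real.log (ell D) := by ring
  -- Lemma 5.8 at `1 + β₁` and Lemma 5.7
  have h58 := lemma58_at_shift_pow15 χ hp hℓ3 h15 (z := beta1 c' D) (by linarith)
  have hLge := hDl D χ (le_trans (le_trans (le_max_right _ _) (le_max_left _ _)) hD) hq hp h15
  have hD3 : 3 ≤ D := Section8Lemma82Steps.three_le_of_ell hℓ3
  have hφ1 : 1 ≤ (D : ℝ) / Nat.totient D := by
    rw [le_div_iff₀ (by exact_mod_cast Nat.totient_pos.mpr (by omega)), one_mul]
    exact_mod_cast Nat.totient_le D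
  have hLlow : 1 / (4 * Real.exp 1) ≤ ‖deriv χ.LFunction 1‖ := by
    rw [div_le_iff₀ (by positivity)]; linarith [hLge, hφ1]
  exact rhoStar_core hℓ1 hα9 hC'0 hC58pos hδ1 h58 hLlow hβ1u

/-- **`𝓡₂* = β₁ + O(𝓛⁻¹⁰)` from Assumption (A) with ANY exponent `E ≥ 15`** (`Repair.Bed.AssumptionAWith E`;
printed `E = 2022`). [cite: Zhang2022LandauSiegel, §16 p. 95] -/
theorem rhoStar_estimate_of_assumptionAWith (c' : ℝ) {E : ℝ} (hE : 15 ≤ E) (h54 : Lemma54) :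
    ∃ C : ℝ, ForAllLarge fun D _ χ => AssumptionAWith E D χ →
    ‖χ.LFunction (1 + beta1 c' D) / deriv χ.LFunction 1 * deltaW D 1 - beta1 c' D‖ ≤
      C * (ell D ^ 10)⁻¹ := by
  obtain ⟨C, h⟩ := rhoStar_estimate_pow15 c' h54
  exact ⟨C, forAllLarge_assumptionAWith_of_pow15 hE h⟩

/-! ## `𝓡₂ⱼ = −1/(β₁L′(1,χ)) + O(𝓛⁶)` under `‖L(1,χ)‖ ≤ 𝓛⁻¹⁵` -/

/-- **§16 p. 95 «`𝓡₂ⱼ = −1/(β₁L′(1,χ)) + O(𝓛⁶)`, `j = 1, 2`» under the minimum premise** (twin of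
`Skeleton.rho2_estimate`, same `O`-constant `512eM + 1024e²C₅₈/π² + 64eK₃/π + 64e/π + 192e|c′|`): for all large `D`
and every real primitive `χ (mod D)` with `‖L(1,χ)‖ ≤ 𝓛⁻¹⁵`, the residues `𝓡₂ⱼ = lim_{s→−βⱼ}(s+βⱼ)·(16.11)(s)` satisfy
`‖𝓡₂ⱼ + 1/(β₁L′(1,χ))‖ ≤ C𝓛⁶` — the tree's wrapper verbatim over `Skeleton.residue_one_final` /
`Skeleton.residue_two_final`, with the (A)-guarded Lemma 5.7 / 5.8 replaced by their `𝓛⁻¹⁵` doors; no other use of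
(A) occurs in this step. [cite: Zhang2022LandauSiegel, §16 p. 95] -/
theorem rho2_estimate_pow15 (c' : ℝ) : ∃ C : ℝ, ForAllLarge fun D _ χ =>
    ‖χ.LFunction 1‖ ≤ 1 / Real.log D ^ 15 →
    ∀ j ∈ ({1, 2} : Finset ℕ),
      ‖limUnder (𝓝[≠] (-betaJ c' D j)) (fun s => (s + betaJ c' D j) *
          (riemannZeta (1 + s + beta1 c' D) / (riemannZeta (1 + s) * χ.LFunction (1 + s)) *
            (((P4 D : ℝ) : ℂ) ^ (s + beta2 c' D) * GaussWeight.omega1 (ell D ^ 30) (s + beta2 c' D) /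
              (s + beta2 c' D)))) +
        1 / (beta1 c' D * deriv χ.LFunction 1)‖ ≤ C * ell D ^ 6 := by
  obtain ⟨r, hr, M, hM, hζ⟩ := zeta_near_one_shift
  set C58 : ℝ := 1 + 16 * Real.exp (9 / 2) * π ^ 2 * 10 ^ 2 with hC58
  have hC58pos : 0 ≤ C58 := by positivity
  set K3 : ℝ := 521 * π + 3654 * π ^ 2 * |c'| with hK3
  have hK3pos : 0 ≤ K3 := by positivity
  obtain ⟨Dl, hDl⟩ := self_div_totient_le_norm_deriv_L_one_pow15
  obtain ⟨D₂, h₂⟩ := exists_forall_le_ell (max (max 3 (14 * π * |c'| + 1))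
    (max (max (3 * π / r + 1) (12 * M * π + 1)) (max (32 * Real.exp 1 * C58 / π + 1) (K3 + 1))))
  refine ⟨512 * Real.exp 1 * M + 1024 * Real.exp 1 ^ 2 * C58 / π ^ 2 + 64 * Real.exp 1 * K3 / π +
    64 * Real.exp 1 / π + 192 * Real.exp 1 * |c'|, max D₂ Dl, fun D _ χ hD hq hp h15 j hj => ?_⟩
  -- thresholds on `𝓛`
  have hT := h₂ D (le_trans (le_max_left _ _) hD)
  have hℓ3 : 3 ≤ ell D := le_trans (le_trans (le_max_left _ _) (le_max_left _ _)) hT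
  have hℓc : 14 * π * |c'| + 1 ≤ ell D := le_trans (le_trans (le_max_right _ _) (le_max_left _ _)) hT
  have hℓr : 3 * π / r + 1 ≤ ell D :=
    le_trans (le_trans (le_trans (le_max_left _ _) (le_max_left _ _)) (le_max_right _ _)) hT
  have hℓM : 12 * M * π + 1 ≤ ell D :=
    le_trans (le_trans (le_trans (le_max_right _ _) (le_max_left _ _)) (le_max_right _ _)) hT
  have hℓE : 32 * Real.exp 1 * C58 / π + 1 ≤ ell D :=
    le_trans (le_trans (le_trans (le_max_left _ _) (le_max_right _ _)) (le_max_right _ _)) hT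
  have hℓK : K3 + 1 ≤ ell D :=
    le_trans (le_trans (le_trans (le_max_right _ _) (le_max_right _ _)) (le_max_right _ _)) hT
  have hℓ1 : 1 ≤ ell D := by linarith
  have hℓ0 : 0 < ell D := by linarith
  have hα9 : alpha D * ell D ^ 9 = π := alpha_mul_ell_pow_nine hℓ0
  have hα : 0 < alpha D := alpha_pos_of_ell_pos hℓ0
  obtain ⟨hc14, h5⟩ := c_alpha_ell_small c' hℓ1 hℓc
  obtain ⟨hβ1l, hβ1u⟩ := norm_beta1_bounds c' hα.le (by positivity) h5
  obtain ⟨hβ2l, hβ2u, hγl, hγu, hν⟩ := beta_sizes c' hα.le (by positivity) hc14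
  obtain ⟨h3αr, h6M, h4M⟩ := alpha_small_rM (D := D) hr hM hℓ1 hℓr hℓM
  have hβ10 : beta1 c' D ≠ 0 := norm_pos_iff.mp (by linarith)
  have hβ20 : beta2 c' D ≠ 0 := norm_pos_iff.mp (by linarith)
  have hγ0 : beta2 c' D - beta1 c' D ≠ 0 := norm_pos_iff.mp (by linarith)
  have hD3 : 3 ≤ D := Section8Lemma82Steps.three_le_of_ell hℓ3
  have hχ1 : χ ≠ 1 := ne_one_of_isPrimitive_of_three_le hp hD3
  have hLge := hDl D χ (le_trans (le_max_right _ _) hD) hq hp h15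
  have hφ1 : 1 ≤ (D : ℝ) / Nat.totient D := by
    rw [le_div_iff₀ (by exact_mod_cast Nat.totient_pos.mpr (by omega)), one_mul]
    exact_mod_cast Nat.totient_le D
  have hLlow : 1 / (4 * Real.exp 1) ≤ ‖deriv χ.LFunction 1‖ := by
    rw [div_le_iff₀ (by positivity)]; linarith [hLge, hφ1]
  have hP4 : 0 < P4 D := P4_pos hℓ0
  have hδ3 := norm_P4_cpow_add_one_le c' (D := D) hℓ1
  have hK3ℓ : K3 * (ell D ^ 6)⁻¹ ≤ 1 := by
    rw [← div_eq_mul_inv, div_le_one (by positivity)]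
    linarith [le_self_pow₀ hℓ1 (by norm_num : (6 : ℕ) ≠ 0)]
  obtain ⟨-, h21, -⟩ := beta2_eq_I_mul c' D
  have hδ4 := norm_omega1_div_sub_inv_le (Λ := ell D ^ 30)
    (b := alpha D * (1 + 7 * c' * alpha D * ell D)) (by positivity)
  rw [← h21] at hδ4
  obtain ⟨hδ4v, hδ4one⟩ := weight_error_small (D := D) hℓ3 hγu (norm_nonneg _)
  simp only [Finset.mem_insert, Finset.mem_singleton] at hj
  rcases hj with rfl | rfl
  · have hb1 : betaJ c' D 1 = beta1 c' D := by simp [betaJ]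
    rw [hb1]
    have hz1 : ‖riemannZeta (1 - beta1 c' D) - (-beta1 c' D)⁻¹‖ ≤ M := by
      have := hζ (-beta1 c' D) (neg_ne_zero.mpr hβ10) (by rw [norm_neg]; linarith)
      rwa [← sub_eq_add_neg] at this
    have hL1 : ‖χ.LFunction (1 - beta1 c' D) - (-(beta1 c' D * deriv χ.LFunction 1))‖ ≤
        C58 / ell D ^ 15 := by
      have := lemma58_at_shift_pow15 χ hp hℓ3 h15 (z := -beta1 c' D) (by rw [norm_neg]; linarith)
      rwa [← sub_eq_add_neg, show deriv χ.LFunction 1 * -beta1 c' D =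
        -(beta1 c' D * deriv χ.LFunction 1) by ring] at this
    exact residue_one_final c' χ hℓ1 hα9 hα hM h4M hχ1 hP4 hβ1l hβ1u hγl hν hLlow hz1 hC58pos hL1
      (lemma58_error_small hℓ1 hℓE hβ1l hLlow) hK3pos hK3ℓ hδ3 (by positivity) hδ4one hδ4v
      hδ4
  · have hb2' : betaJ c' D 2 = beta2 c' D := by simp [betaJ]
    rw [hb2']
    have hz2 : ‖riemannZeta (1 + beta1 c' D - beta2 c' D) - (-(beta2 c' D - beta1 c' D))⁻¹‖ ≤ M := by
      have := hζ (-(beta2 c' D - beta1 c' D)) (neg_ne_zero.mpr hγ0) (by rw [norm_neg]; linarith)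
      rwa [show (1 : ℂ) + -(beta2 c' D - beta1 c' D) = 1 + beta1 c' D - beta2 c' D by ring] at this
    have hz3 : ‖riemannZeta (1 - beta2 c' D) - (-beta2 c' D)⁻¹‖ ≤ M := by
      have := hζ (-beta2 c' D) (neg_ne_zero.mpr hβ20) (by rw [norm_neg]; linarith)
      rwa [← sub_eq_add_neg] at this
    have hL2 : ‖χ.LFunction (1 - beta2 c' D) - (-(beta2 c' D * deriv χ.LFunction 1))‖ ≤
        C58 / ell D ^ 15 := by
      have := lemma58_at_shift_pow15 χ hp hℓ3 h15 (z := -beta2 c' D) (by rw [norm_neg]; linarith)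
      rwa [← sub_eq_add_neg, show deriv χ.LFunction 1 * -beta2 c' D =
        -(beta2 c' D * deriv χ.LFunction 1) by ring] at this
    exact residue_two_final c' χ hℓ1 hα9 hα hM h6M hχ1 hP4 hβ1l hβ2l hβ2u hγl hγu hν hLlow hz2 hz3
      hC58pos hL2 (lemma58_error_small hℓ1 hℓE (by linarith) hLlow) hK3pos

/-- **`𝓡₂ⱼ = −1/(β₁L′(1,χ)) + O(𝓛⁶)` from Assumption (A) with ANY exponent `E ≥ 15`** (`Repair.Bed.AssumptionAWith E`;
printed `E = 2022`). [cite: Zhang2022LandauSiegel, §16 p. 95] -/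
theorem rho2_estimate_of_assumptionAWith (c' : ℝ) {E : ℝ} (hE : 15 ≤ E) :
    ∃ C : ℝ, ForAllLarge fun D _ χ => AssumptionAWith E D χ →
    ∀ j ∈ ({1, 2} : Finset ℕ),
      ‖limUnder (𝓝[≠] (-betaJ c' D j)) (fun s => (s + betaJ c' D j) *
          (riemannZeta (1 + s + beta1 c' D) / (riemannZeta (1 + s) * χ.LFunction (1 + s)) *
            (((P4 D : ℝ) : ℂ) ^ (s + beta2 c' D) * GaussWeight.omega1 (ell D ^ 30) (s + beta2 c' D) /
              (s + beta2 c' D)))) +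
        1 / (beta1 c' D * deriv χ.LFunction 1)‖ ≤ C * ell D ^ 6 := by
  obtain ⟨C, h⟩ := rho2_estimate_pow15 c'
  exact ⟨C, forAllLarge_assumptionAWith_of_pow15 hE h⟩

end Literature.NumberTheory.LFunctions.Zhang2022.Repair.Gap
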